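import Literature.MathematicalPhysics.QuantumLattice.TorusSectorGibbsParticleHole
import Literature.MathematicalPhysics.QuantumLattice.PairCorrelationsProofs
import Literature.MathematicalPhysics.QuantumLattice.TorusLimitOfMixturesCompactness
import HarnessLib

/-!
# The particle–hole dictionary of thermal torus limits: density `2 - n` and mean energy
# `e_{Φ(t,-t',U)}(ω ∘ α) = e_{Φ(t,t',U)}(ω) + U(1 - n)`

Family `hubbard` (topic `MathematicalPhysics/QuantumLattice`); seat `hubbard-downfold-unc-2` (cell
`pub/hubbard-downfold`, row «FILLING direction of BOX → WORD», electron-doped half at `T > 0`). Sequel of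
`TorusSectorGibbsParticleHole` (the particle–hole transform `ω ∘ α` of a torus limit `ω` of the canonical Gibbs
states of `H_L(t, t', U)` at density `n`, along eventually-even `Ls → ∞`, is a torus limit of the canonical Gibbs
states of `H_L(t, -t', U)` at the reflected densities; the finite-volume identity
`Σ_i p_i ⟨ψ_i, α(X) ψ_i⟩ = Σ_j p'_j ⟨ψ'_j, X ψ'_j⟩`). Here the two scalar words of the phase-map cells are read
through it:

* `IsTorusLimitOfMixture.density_particleHole_of_sectorGibbs` — `ρ(ω ∘ α) = 2 - n`: electron doping `n > 1` of
  the `t'` model is hole doping `2 - n` (needs no parity of `Ls`);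
* `IsTorusLimitOfMixture.meanEnergy_particleHole_of_sectorGibbs` — for every torus limit `ω` of record at
  `(t, t', U, n, β)` along eventually-even `Ls → ∞`:
  `e_{Φ(t,-t',U)}(ω ∘ α) = e_{Φ(t,t',U)}(ω) + U(1 - n)`
  (finite volume: `Σ_j p'_j ⟨ψ'_j, H_L(t,-t',U) ψ'_j⟩ = Σ_i p_i ⟨ψ_i, H_L(t,t',U) ψ_i⟩ + U(L² - rectN n L)`,
  `sum_sectorGibbsWeightTT'_mul_re_expect_reflected_eq`; then `rectN n L/L² → n` and
  `IsTorusLimitOfMixture.tendsto_meanEnergy_hubbardTTPrime` on both classes) — the `T > 0` twin of the tree's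
  `energyDensityTT'_particleHole` (`e(t,t',U,n) = e(t,-t',U,2-n) + U(n - 1)`); hence every thermal ENERGY WINDOW
  certified for the reflected class transports to the electron-doped class by an explicit shift
  (`IsTorusLimitOfMixture.meanEnergy_mem_Icc_of_particleHole_window`).

* §3 (appended): only eventually-ODD side sequences are excluded — along any `Ls → ∞` with infinitely many even
  sides the statements hold after passing to the even subsequence (`…_of_frequently` forms; torus limits pass to
  subsequences).

Everything is PROVED; no definition, no named fact, no sorry. HONEST LIMITS: even tori (eventually / frequently)
for the state-level statements; no number.

## References
* E. H. Lieb, F. Y. Wu, Physica A 321 (2003) 1, §1 eq. (3) (`E(M, M') = -(N_a - N)U + E(N_a - M, N_a - M')`).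
  [cite: LiebWuPhysicaA2003, §1 eq. (3)]
* F. H. L. Essler et al., *The One-Dimensional Hubbard Model* (2005), §2.2.4 eqs. (2.59)–(2.61).
  [cite: EsslerEtAl2005, §2.2.4 eqs. (2.59)–(2.61)]
* O. Bratteli, A. Kishimoto, D. W. Robinson, CMP 64 (1978) 41, Thm. 2 (mean energy of translation-invariant
  states). [cite: BratteliKishimotoRobinson1978, Thm. 2]

## Mathlib / tree search
REUSED: `IsTorusLimitOfMixture.particleHole_of_sectorGibbs_canonical`, `sum_sectorGibbsWeightTT'_mul_expect_phAut_eq`,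
`halfRectN_two_sub_div_add`, `particleHoleAut_apply` (`TorusSectorGibbsParticleHole` / `InfVolFermionStateParticleHole`);
`IsTorusLimitOfMixture.tendsto_meanEnergy_hubbardTTPrime` (`TorusLimitOfMixtures`);
`IsTorusLimitOfMixture.density_eq_of_sectorGibbs`, `isNParticle_sectorGibbsVectorTT'`,
`star_sectorGibbsVectorTT'_dotProduct_self`, `sum_sectorGibbsWeightTT'` (`TorusSectorGibbsMixture`);
`particleHole_hubbardTorusTT'` (`HubbardNNNHoppingParticleHole`); `totalNumber_mulVec_of_isNParticle`
(`HubbardLangerMattisBound`); `expect_add`, `expect_smul` (`PairCorrelationsProofs`); `tendsto_rectN_div_sq`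
(`InfVolFermionStateDensity`); `density_particleHole` (`InfVolFermionStateParticleHole`).
-/

noncomputable section

namespace Literature.MathematicalPhysics.QuantumLattice

open Matrix Finset HubbardWave0 Literature.Probability.LatticeModels ThermodynamicLimit
open _root_.Filter
open scoped _root_.Topology ComplexOrder BigOperators

/-! ### §1 Finite volume: the reflected thermal energy -/

section Torus

variable {L : ℕ}

/-- The conjugation identity `P H_L(t, -t', U) Pᴴ = H_L(t, t', U) - U N + U L²` (`L` even), restated with this
file's instances. [cite: EsslerEtAl2005, §2.2.4 eqs. (2.59)–(2.61)] -/
private theorem particleHoleAut_hubbardTorusTT'_neg (hL : Even L) (t t' U : ℝ) :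
    particleHoleAut (fun i : Orb (FermionTorus 2 L) => torusStagger (ofLex i).1) (hubbardTorusTT' L t (-t') U) =
      hubbardTorusTT' L t t' U - (U : ℂ) • totalNumber +
        ((U * L ^ 2 : ℝ) : ℂ) • (1 : Matrix (Finset (Orb (FermionTorus 2 L))) (Finset (Orb (FermionTorus 2 L))) ℂ) := by
  rw [particleHoleAut_apply]
  have h := particleHole_hubbardTorusTT' hL t (-t') U
  rw [neg_neg] at h
  convert h

/-- In a unit vector of the sector of record, `⟨ψ, (H - U N + U L²·1) ψ⟩ = ⟨ψ, H ψ⟩ + U(L² - rectN n L)`.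
[cite: LiebWuPhysicaA2003, §1 eq. (3)] -/
private theorem expect_sub_totalNumber_add_one (t t' U n : ℝ) (L : ℕ) (i : Fin (sectorGibbsCount n L)) :
    expect (hubbardTorusTT' L t t' U - (U : ℂ) • totalNumber +
        ((U * L ^ 2 : ℝ) : ℂ) • (1 : Matrix (Finset (Orb (FermionTorus 2 L))) (Finset (Orb (FermionTorus 2 L))) ℂ))
        (sectorGibbsVectorTT' t t' U n L i) =
      expect (hubbardTorusTT' L t t' U) (sectorGibbsVectorTT' t t' U n L i) +
        ((U * ((L : ℝ) ^ 2 - rectN n L) : ℝ) : ℂ) := by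
  set ψ := sectorGibbsVectorTT' t t' U n L i with hψ
  have hN : totalNumber *ᵥ ψ = ((rectN n L : ℕ) : ℂ) • ψ :=
    totalNumber_mulVec_of_isNParticle (isNParticle_sectorGibbsVectorTT' t t' U n L i)
  have h1 : star ψ ⬝ᵥ ψ = 1 := star_sectorGibbsVectorTT'_dotProduct_self t t' U n L i
  rw [sub_eq_add_neg, ← neg_smul, expect_add, expect_add, expect_smul, expect_smul]
  unfold expect
  rw [hN, one_mulVec, dotProduct_smul, h1]
  simp only [smul_eq_mul, mul_one]
  push_cast
  ring

/-- **The reflected thermal energy in finite volume** (`L` even, `0 ≤ n ≤ 2`, `halfRectN n' L + halfRectN n L = L²`):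
`Σ_j p'_j Re⟨ψ'_j, H_L(t,-t',U) ψ'_j⟩ = Σ_i p_i Re⟨ψ_i, H_L(t,t',U) ψ_i⟩ + U(L² - rectN n L)`, `(p, ψ)` the canonical
data of `H_L(t,t',U)` at `n`, `(p', ψ')` those of `H_L(t,-t',U)` at `n'`. [cite: LiebWuPhysicaA2003, §1 eq. (3)] -/
theorem sum_sectorGibbsWeightTT'_mul_re_expect_reflected_eq (hL : Even L) (β t t' U : ℝ) {n n' : ℝ}
    (hn0 : 0 ≤ n) (hn2 : n ≤ 2) (hk : halfRectN n' L + halfRectN n L = L ^ 2) :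
    ∑ j, sectorGibbsWeightTT' β t (-t') U n' L j *
        (expect (hubbardTorusTT' L t (-t') U) (sectorGibbsVectorTT' t (-t') U n' L j)).re =
      ∑ i, sectorGibbsWeightTT' β t t' U n L i *
          (expect (hubbardTorusTT' L t t' U) (sectorGibbsVectorTT' t t' U n L i)).re +
        U * ((L : ℝ) ^ 2 - rectN n L) := by
  have h := sum_sectorGibbsWeightTT'_mul_expect_phAut_eq hL β t t' U hk (hubbardTorusTT' L t (-t') U)
  rw [particleHoleAut_hubbardTorusTT'_neg hL t t' U] at h
  simp_rw [expect_sub_totalNumber_add_one] at h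
  have hre := congrArg Complex.re h
  rw [Complex.re_sum, Complex.re_sum] at hre
  simp only [Complex.mul_re, Complex.ofReal_re, Complex.ofReal_im, zero_mul, sub_zero, Complex.add_re,
    Complex.add_im] at hre
  rw [← hre]
  simp_rw [mul_add]
  rw [Finset.sum_add_distrib, ← Finset.sum_mul, sum_sectorGibbsWeightTT' β t t' U hn0 hn2 L, one_mul]

end Torus

/-! ### §2 The dictionary for torus limits -/

namespace InfVolFermionState

/-- **Electron doping is hole doping**: the particle–hole transform of a thermal torus limit of record at
density `n` has density `2 - n` (any `Ls → ∞`, no parity needed). [cite: EsslerEtAl2005, §2.2.4 eqs. (2.59)–(2.61)] -/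
theorem IsTorusLimitOfMixture.density_particleHole_of_sectorGibbs (t t' U β : ℝ) {n : ℝ} (hn0 : 0 ≤ n)
    (hn2 : n ≤ 2) {Ls : ℕ → ℕ} (hLs : Tendsto Ls atTop atTop) {ω : InfVolFermionState 2}
    (hω : ω.IsTorusLimitOfMixture (sectorGibbsCount n) (fun L => sectorGibbsWeightTT' β t t' U n L)
      (fun L => sectorGibbsVectorTT' t t' U n L) Ls) :
    ω.particleHole.density = 2 - n := by
  rw [density_particleHole, hω.density_eq_of_sectorGibbs t t' U hn0 hn2 β hLs]

/-- **THE MEAN-ENERGY DICTIONARY.** For every torus limit `ω` of the canonical Gibbs states of `H_L(t, t', U)` at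
density `n` (`0 ≤ n ≤ 2`), along `Ls → ∞` with `Ls j` eventually even:
`e_{Φ(t,-t',U)}(ω ∘ α) = e_{Φ(t,t',U)}(ω) + U(1 - n)` — the thermal energy of the electron-doped state in the `t'`
model is the thermal energy of its hole-doped image in the `-t'` model up to the explicit shift (the `T > 0` twin of
`energyDensityTT'_particleHole`). [cite: LiebWuPhysicaA2003, §1 eq. (3)] [cite: BratteliKishimotoRobinson1978, Thm. 2] -/
theorem IsTorusLimitOfMixture.meanEnergy_particleHole_of_sectorGibbs (β t t' U : ℝ) {n : ℝ} (hn0 : 0 ≤ n)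
    (hn2 : n ≤ 2) {Ls : ℕ → ℕ} (hLs : Tendsto Ls atTop atTop) (heven : ∀ᶠ j in atTop, Even (Ls j))
    {ω : InfVolFermionState 2}
    (hω : ω.IsTorusLimitOfMixture (sectorGibbsCount n) (fun L => sectorGibbsWeightTT' β t t' U n L)
      (fun L => sectorGibbsVectorTT' t t' U n L) Ls) :
    ω.particleHole.meanEnergy (hubbardTTPrimeFermionInteraction t (-t') U) 1 =
      ω.meanEnergy (hubbardTTPrimeFermionInteraction t t' U) 1 + U * (1 - n) := by
  have hω' := hω.particleHole_of_sectorGibbs_canonical β t t' U hn0 hn2 hLs heven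
  have hE' := hω'.tendsto_meanEnergy_hubbardTTPrime t (-t') U hLs
  have hE := hω.tendsto_meanEnergy_hubbardTTPrime t t' U hLs
  -- `rectN n L/L² → n`, hence `U(1 - rectN n L/L²) → U(1 - n)`
  have hρ : Tendsto (fun j => U * (1 - (rectN n (Ls j) : ℝ) / (Ls j : ℝ) ^ 2)) atTop (𝓝 (U * (1 - n))) :=
    ((tendsto_rectN_div_sq hn0).comp hLs).const_sub 1 |>.const_mul U
  refine tendsto_nhds_unique hE' ((hE.add hρ).congr' ?_)
  filter_upwards [hLs.eventually_ge_atTop 1, heven] with j hj hev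
  have h1 : (1 : ℝ) ≤ (Ls j : ℝ) := by exact_mod_cast hj
  have hL0 : (0 : ℝ) < (Ls j : ℝ) ^ 2 := by positivity
  have hrefl := sum_sectorGibbsWeightTT'_mul_re_expect_reflected_eq hev β t t' U hn0 hn2
    (halfRectN_two_sub_div_add hn0 hn2 hj)
  simp_rw [← mul_div_assoc]
  rw [← Finset.sum_div, ← Finset.sum_div, hrefl]
  field_simp

/-- **Energy windows transport across the particle–hole map.** If every torus limit `ω'` of the canonical Gibbs
states of `H_L(t, -t', U)` at the reflected densities `2 - 2k_L/L²` (along the given eventually-even `Ls`) obeys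
`lo ≤ e_{Φ(t,-t',U)}(ω') ≤ hi`, then the torus limit `ω` of record at `(t, t', U, n, β)` along `Ls` obeys
`lo - U(1 - n) ≤ e_{Φ(t,t',U)}(ω) ≤ hi - U(1 - n)`. [cite: LiebWuPhysicaA2003, §1 eq. (3)] -/
theorem IsTorusLimitOfMixture.meanEnergy_mem_Icc_of_particleHole_window (β t t' U : ℝ) {n : ℝ} (hn0 : 0 ≤ n)
    (hn2 : n ≤ 2) {Ls : ℕ → ℕ} (hLs : Tendsto Ls atTop atTop) (heven : ∀ᶠ j in atTop, Even (Ls j)) {lo hi : ℝ}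
    (hW : ∀ ω' : InfVolFermionState 2,
      ω'.IsTorusLimitOfMixture (fun L => sectorGibbsCount (2 - 2 * (halfRectN n L : ℝ) / (L : ℝ) ^ 2) L)
        (fun L => sectorGibbsWeightTT' β t (-t') U (2 - 2 * (halfRectN n L : ℝ) / (L : ℝ) ^ 2) L)
        (fun L => sectorGibbsVectorTT' t (-t') U (2 - 2 * (halfRectN n L : ℝ) / (L : ℝ) ^ 2) L) Ls →
      ω'.meanEnergy (hubbardTTPrimeFermionInteraction t (-t') U) 1 ∈ Set.Icc lo hi)
    {ω : InfVolFermionState 2}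
    (hω : ω.IsTorusLimitOfMixture (sectorGibbsCount n) (fun L => sectorGibbsWeightTT' β t t' U n L)
      (fun L => sectorGibbsVectorTT' t t' U n L) Ls) :
    ω.meanEnergy (hubbardTTPrimeFermionInteraction t t' U) 1 ∈ Set.Icc (lo - U * (1 - n)) (hi - U * (1 - n)) := by
  have h := hW _ (hω.particleHole_of_sectorGibbs_canonical β t t' U hn0 hn2 hLs heven)
  rw [hω.meanEnergy_particleHole_of_sectorGibbs β t t' U hn0 hn2 hLs heven] at h
  constructor <;> linarith [h.1, h.2]

/-! ### §3 Only eventually-ODD side sequences are excluded: words along `Ls` with infinitely many even sides -/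

/-- **Subsequence form of the class statement.** If the side sequence `Ls → ∞` has infinitely many EVEN terms on
which the sectors of record at `n` and `2 - n` are complementary, then along the extracted subsequence `Ls ∘ φ`
the particle–hole transform of a record torus limit `ω` at `(t, t', U, n, β)` is a record torus limit at
`(t, -t', U, 2 - n, β)` (torus limits pass to subsequences, `IsTorusLimitOfMixture.comp_tendsto`).
[cite: LiebWuPhysicaA2003, §1 eq. (3)] [cite: BratteliRobinsonI1987, §4.3.1 (PDF pp. 373–375)] -/
theorem IsTorusLimitOfMixture.exists_particleHole_of_sectorGibbs_of_frequently (β t t' U n : ℝ) {Ls : ℕ → ℕ}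
    (hLs : Tendsto Ls atTop atTop)
    (hfreq : ∃ᶠ j in atTop, Even (Ls j) ∧ halfRectN (2 - n) (Ls j) + halfRectN n (Ls j) = Ls j ^ 2)
    {ω : InfVolFermionState 2}
    (hω : ω.IsTorusLimitOfMixture (sectorGibbsCount n) (fun L => sectorGibbsWeightTT' β t t' U n L)
      (fun L => sectorGibbsVectorTT' t t' U n L) Ls) :
    ∃ φ : ℕ → ℕ, StrictMono φ ∧
      ω.particleHole.IsTorusLimitOfMixture (sectorGibbsCount (2 - n))
        (fun L => sectorGibbsWeightTT' β t (-t') U (2 - n) L) (fun L => sectorGibbsVectorTT' t (-t') U (2 - n) L)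
        (Ls ∘ φ) := by
  obtain ⟨φ, hφ, hev⟩ := extraction_of_frequently_atTop hfreq
  exact ⟨φ, hφ, (hω.comp_tendsto hφ.tendsto_atTop).particleHole_of_sectorGibbs_of_add β t t' U n
    (hLs.comp hφ.tendsto_atTop) (Eventually.of_forall fun j => (hev j).1) (Eventually.of_forall fun j => (hev j).2)⟩

/-- **Every word for the reflected record class reads on `ω ∘ α` as soon as `Ls` is NOT eventually odd** (and the
sectors are complementary on infinitely many even sides): words proved «for every torus limit along every `Ls' → ∞`»
of the record class at `(t, -t', U, 2 - n, β)` hold for the particle–hole transform of every record torus limit at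
`(t, t', U, n, β)` along such `Ls`. [cite: LiebWuPhysicaA2003, §1 eq. (3)] -/
theorem IsTorusLimitOfMixture.forall_particleHole_of_sectorGibbs_of_frequently (β t t' U n : ℝ)
    {P : InfVolFermionState 2 → Prop}
    (hP : ∀ (Ls' : ℕ → ℕ) (ω' : InfVolFermionState 2), Tendsto Ls' atTop atTop →
      ω'.IsTorusLimitOfMixture (sectorGibbsCount (2 - n)) (fun L => sectorGibbsWeightTT' β t (-t') U (2 - n) L)
        (fun L => sectorGibbsVectorTT' t (-t') U (2 - n) L) Ls' → P ω')
    {Ls : ℕ → ℕ} (hLs : Tendsto Ls atTop atTop)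
    (hfreq : ∃ᶠ j in atTop, Even (Ls j) ∧ halfRectN (2 - n) (Ls j) + halfRectN n (Ls j) = Ls j ^ 2)
    {ω : InfVolFermionState 2}
    (hω : ω.IsTorusLimitOfMixture (sectorGibbsCount n) (fun L => sectorGibbsWeightTT' β t t' U n L)
      (fun L => sectorGibbsVectorTT' t t' U n L) Ls) :
    P ω.particleHole := by
  obtain ⟨φ, hφ, h⟩ := hω.exists_particleHole_of_sectorGibbs_of_frequently β t t' U n hLs hfreq
  exact hP (Ls ∘ φ) _ (hLs.comp hφ.tendsto_atTop) h

/-- **The mean-energy dictionary along `Ls` with infinitely many even sides** (no complementarity needed):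
`e_{Φ(t,-t',U)}(ω ∘ α) = e_{Φ(t,t',U)}(ω) + U(1 - n)` — both sides are properties of the states, and `ω` is also
the torus limit along the even subsequence. [cite: LiebWuPhysicaA2003, §1 eq. (3)] -/
theorem IsTorusLimitOfMixture.meanEnergy_particleHole_of_sectorGibbs_of_frequently (β t t' U : ℝ) {n : ℝ}
    (hn0 : 0 ≤ n) (hn2 : n ≤ 2) {Ls : ℕ → ℕ} (hLs : Tendsto Ls atTop atTop) (hfreq : ∃ᶠ j in atTop, Even (Ls j))
    {ω : InfVolFermionState 2}
    (hω : ω.IsTorusLimitOfMixture (sectorGibbsCount n) (fun L => sectorGibbsWeightTT' β t t' U n L)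
      (fun L => sectorGibbsVectorTT' t t' U n L) Ls) :
    ω.particleHole.meanEnergy (hubbardTTPrimeFermionInteraction t (-t') U) 1 =
      ω.meanEnergy (hubbardTTPrimeFermionInteraction t t' U) 1 + U * (1 - n) := by
  obtain ⟨φ, hφ, hev⟩ := extraction_of_frequently_atTop hfreq
  exact (hω.comp_tendsto hφ.tendsto_atTop).meanEnergy_particleHole_of_sectorGibbs β t t' U hn0 hn2
    (hLs.comp hφ.tendsto_atTop) (Eventually.of_forall hev)

end InfVolFermionState

end Literature.MathematicalPhysics.QuantumLattice
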